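import Literature.IUT.HodgeArakelov.LabelClassesOfCusps
import Mathlib.NumberTheory.Padics.RingHoms
import Mathlib.GroupTheory.Index
import Mathlib.Data.Nat.Prime.Infinite
import Mathlib.Topology.DenseEmbedding

/-!
# [IUTchII] §2 Cor 2.4 / Rmk 2.4.1 — NEGATIVE companions (G11) for `LabelClassesOfCusps.lean` (p407174)

Proof-only file (abc-iut cell, RQ7 audit seat abc-iut-L6-t19; L6-lead compliance order 2026-08-25T20:42:11Z (3)).
It records, as kernel theorems over the LANDED declarations of
`Literature/IUT/HodgeArakelov/LabelClassesOfCusps.lean`, why two of its `Prop`-valued renderings are not the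
printed statements (S. Mochizuki, *Inter-universal Teichmüller theory II*, kurims manuscript Dec. 2020,
pp. 69–71), so that the primed repairs `Cor24_ii_iii'` / `Rmk241_openOrTrivial'` are the decls of record:

* `Cor24_ii_iii W C H` (Cor. 2.4 (ii)(iii), p. 70) quantifies its first conjunct over ALL subgroups `I` with
  `I^δ ⊆ Π^δ_{v□}` — not only over cuspidal inertia groups `I_t` of label `t` — while `TwoTorsionTranslates.Dt`
  is the normaliser of `I^δ` in `Π^δ_v` (DEFINED). At `I := ⊥` the normaliser is all of `Π^δ_v`, so the conjunct
  forces `Π_v ⊆ Π_{v□̈}`; together with the printed index `[Π_{v□} : Π_{v□̈}] = 2` (`Cor24_indices`, p. 69) this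
  is contradictory: `Cor24_indices W H → ¬ Cor24_ii_iii W C H` for EVERY tower (finding L6t1-F1 of
  abc-iut-L6-t20, sharpened by abc-iut-L6-d1 F9; kernel form below).
* `Rmk241_openOrTrivial I'` (Rmk. 2.4.1, p. 71: "every closed subgroup of such a maximal pro-`l'` subgroup is
  either open or trivial") drops the word "closed": for the abstract group underlying `ℤ_{l'}` the subgroup
  generated by `1` is neither trivial nor of finite index (finding T1-F3 of abc-iut-L6-t19) — while the
  PRINTED statement holds at the model: every closed additive subgroup of `ℤ_p` is `⊥` or of finite index
  (`closed_addSubgroup_padicInt_bot_or_finiteIndex`, proved: closed subgroups are ideals by density of `ℤ`,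
  and the nonzero ideals of `ℤ_p` are the `p^n ℤ_p`).

Nothing here takes a side on [IUTchIII] Cor. 3.12; the theorems concern the cell's typings only.
-/

namespace Literature.IUT.HodgeArakelov

universe u

section Cor24

variable {S : BadPlaceSetting.{u}} {P : TopGroup.{u}} {T : TemperedCoverings S P}

namespace PlusMinusTower

variable (W : PlusMinusTower T) (H : Subgroup P)

/-- `Π_{v□̈} ⊆ Π_{v□}` (both DEFINED in `LabelClassesOfCusps.lean` as images in `Π̂^cor_v`).
[cite: Mochizuki2012, Cor 2.4 p.69] -/
theorem boxDd_le_box : W.boxDd H ≤ W.box H :=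
  Subgroup.map_mono inf_le_left

/-- `Π_{v□} ⊆ Π_v` inside `Π̂^cor_v`. [cite: Mochizuki2012, Cor 2.4 p.69] -/
theorem box_le_piV : W.box H ≤ W.piV := by
  rintro _ ⟨x, -, rfl⟩
  exact ⟨x, rfl⟩

end PlusMinusTower

/-- At `I := ⊥` the "decomposition group" `D^δ_t := N_{Π^δ_v}(I^δ_t)` of `TwoTorsionTranslates.Dt` is all of
`Π^δ_v`: the typed datum does not see the cusp. [cite: Mochizuki2012, Cor 2.4 (ii) p.70] -/
theorem TwoTorsionTranslates.Dt_bot {W : PlusMinusTower T} {H : Subgroup P} {δ : W.Corhat}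
    (X : TwoTorsionTranslates W H ⊥ δ) : X.Dt = W.piV.map (MulAut.conj δ).toMonoidHom := by
  unfold TwoTorsionTranslates.Dt
  rw [Subgroup.map_bot, Subgroup.bot_subgroupOf, Subgroup.normalizer_eq_top, ← MonoidHom.range_eq_map,
    Subgroup.range_subtype]

/-- The first conjunct of `Cor24_ii_iii`, instantiated at the non-cuspidal subgroup `I := ⊥` (allowed by
the typing), forces `Π_v ⊆ Π_{v□̈}`. [cite: Mochizuki2012, Cor 2.4 (ii) p.70] -/
theorem piV_le_boxDd_of_Cor24_ii_iii (W : PlusMinusTower T) (C : CuspidalInertiaData W) (H : Subgroup P)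
    (h : Cor24_ii_iii W C H) : W.piV ≤ W.boxDd H := by
  obtain ⟨data, h1, -⟩ := h
  have hincl : (⊥ : Subgroup W.Corhat).map (MulAut.conj (1 : W.Corhat)).toMonoidHom ≤
      (W.box H).map (MulAut.conj (1 : W.Corhat)).toMonoidHom := by
    rw [Subgroup.map_bot]
    exact bot_le
  have key := h1 ⊥ 1 hincl
  rw [TwoTorsionTranslates.Dt_bot] at key
  exact (Subgroup.map_le_map_iff_of_injective (MulAut.conj (1 : W.Corhat)).injective).mp key

/-- Hence `Cor24_ii_iii` forces `Π_{v□̈} = Π_{v□} = Π_v` inside `Π̂^cor_v`. [cite: Mochizuki2012, Cor 2.4 (ii) p.70] -/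
theorem boxDd_eq_box_of_Cor24_ii_iii (W : PlusMinusTower T) (C : CuspidalInertiaData W) (H : Subgroup P)
    (h : Cor24_ii_iii W C H) : W.boxDd H = W.box H :=
  le_antisymm (W.boxDd_le_box H) ((W.box_le_piV H).trans (piV_le_boxDd_of_Cor24_ii_iii W C H h))

/-- **`Cor24_indices` and `Cor24_ii_iii` are jointly inconsistent, for every tower `W`, interface `C` and
subgroup `Π_{v□} = H`**: the printed index `[Π_{v□} : Π_{v□̈}] = 2` (p. 69) contradicts the consequence
`Π_{v□̈} = Π_{v□}` of the typed Cor. 2.4 (ii)(iii). The printed Cor. 2.4 (ii) speaks only of cuspidal inertia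
groups `I_t` of label `t` with `I_t ⊆ Δ_{v□}` (as `Cor24_i` does); the repair `Cor24_ii_iii'` guards the
quantifier accordingly. [cite: Mochizuki2012, Cor 2.4 (ii) p.70] -/
theorem not_Cor24_ii_iii_of_Cor24_indices (W : PlusMinusTower T) (C : CuspidalInertiaData W)
    (H : Subgroup P) (hidx : Cor24_indices W H) : ¬ Cor24_ii_iii W C H := by
  intro h
  have heq := boxDd_eq_box_of_Cor24_ii_iii W C H h
  have hone : ((W.boxDd H).subgroupOf (W.box H)).index = 1 := by
    rw [heq, Subgroup.subgroupOf_self, Subgroup.index_top]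
  have htwo := hidx.1
  omega

/-- Index-free form: `Cor24_ii_iii` fails as soon as `Π_v ⊄ Π_{v□̈}` (e.g. whenever `Π^tp_{Ÿ̲_v} ≠ Π_v` or
`Π_{v□} ≠ Π_v`). [cite: Mochizuki2012, Cor 2.4 (ii) p.70] -/
theorem not_Cor24_ii_iii (W : PlusMinusTower T) (C : CuspidalInertiaData W) (H : Subgroup P)
    (hne : ¬ W.piV ≤ W.boxDd H) : ¬ Cor24_ii_iii W C H :=
  fun h => hne (piV_le_boxDd_of_Cor24_ii_iii W C H h)

end Cor24

section Rmk241

open Subgroup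

/-- **The typed Rmk. 2.4.1 predicate fails for the abstract group underlying `ℤ_p`** (written
multiplicatively; `I' = ⊤`): the subgroup generated by `1` is neither `⊥` nor of finite index — if it had
index `n`, then `n • q⁻¹ ∈ ℤ · 1` for a prime `q > max n p`, i.e. `q ∣ n`. Print (p. 71) says "every CLOSED
subgroup … is either open or trivial"; the closure hypothesis is what the typing dropped (T1-F3).
[cite: Mochizuki2012, Rmk 2.4.1 p.71] -/
theorem not_Rmk241_openOrTrivial_padicInt (p : ℕ) [hp : Fact p.Prime] :
    ¬ Rmk241_openOrTrivial (⊤ : Subgroup (Multiplicative ℤ_[p])) := by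
  intro h
  set K : Subgroup (Multiplicative ℤ_[p]) := zpowers (Multiplicative.ofAdd (1 : ℤ_[p])) with hK
  rcases h K le_top with hbot | hfin
  · have h1 : Multiplicative.ofAdd (1 : ℤ_[p]) ∈ K := mem_zpowers _
    rw [hbot, mem_bot] at h1
    have h2 : (1 : ℤ_[p]) = 0 := Multiplicative.ofAdd.injective h1
    exact one_ne_zero h2
  · -- `n := [⊤ : K] ≠ 0`, and every `n`-th power lies in `K`
    haveI := hfin
    set n := (K.subgroupOf ⊤).index with hn
    have hn0 : n ≠ 0 := FiniteIndex.index_ne_zero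
    have key : ∀ x : ℤ_[p], ∃ m : ℤ, (m : ℤ_[p]) = (n : ℤ_[p]) * x := by
      intro x
      have hx : (⟨Multiplicative.ofAdd x, mem_top _⟩ : (⊤ : Subgroup (Multiplicative ℤ_[p]))) ^ n ∈
          K.subgroupOf ⊤ := pow_index_mem _ _
      rw [mem_subgroupOf] at hx
      change (Multiplicative.ofAdd x) ^ n ∈ K at hx
      rw [hK, mem_zpowers_iff] at hx
      obtain ⟨m, hm⟩ := hx
      refine ⟨m, ?_⟩
      rw [← ofAdd_zsmul, ← ofAdd_nsmul] at hm
      have hm' : m • (1 : ℤ_[p]) = n • x := Multiplicative.ofAdd.injective hm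
      rw [zsmul_eq_mul, mul_one, nsmul_eq_mul] at hm'
      exact hm'
    -- pick a prime `q > max n p`; it is a unit in `ℤ_[p]`
    obtain ⟨q, hq, hqprime⟩ := Nat.exists_infinite_primes (max n p + 1)
    have hqn : n < q := by omega
    have hqp : p < q := by omega
    have hndvd : ¬ (p : ℤ) ∣ (q : ℤ) := by
      intro hd
      have : p ∣ q := by exact_mod_cast hd
      have := (Nat.prime_dvd_prime_iff_eq hp.out hqprime).mp this
      omega
    have hnorm : ‖((q : ℤ) : ℤ_[p])‖ = 1 := by
      refine le_antisymm (PadicInt.norm_le_one _) ?_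
      by_contra hlt
      exact hndvd ((PadicInt.norm_int_lt_one_iff_dvd _).mp (not_le.mp hlt))
    have hunit : IsUnit ((q : ℤ) : ℤ_[p]) := PadicInt.isUnit_iff.mpr hnorm
    obtain ⟨u, hu⟩ := hunit
    -- apply `key` to `x := u⁻¹`
    obtain ⟨m, hm⟩ := key (↑u⁻¹ : ℤ_[p])
    have hmq : (m : ℤ_[p]) * (q : ℤ) = (n : ℤ_[p]) := by
      rw [hm, mul_assoc, ← hu, Units.inv_mul, mul_one]
    -- cast down to `ℤ`
    have hint : (m * q : ℤ) = (n : ℤ) := by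
      have : ((m * q : ℤ) : ℤ_[p]) = ((n : ℤ) : ℤ_[p]) := by push_cast; exact_mod_cast hmq
      exact_mod_cast this
    have hdvd : (q : ℤ) ∣ (n : ℤ) := ⟨m, by rw [← hint, mul_comm]⟩
    have hdvd' : q ∣ n := by exact_mod_cast hdvd
    exact absurd (Nat.le_of_dvd (Nat.pos_of_ne_zero hn0) hdvd') (not_le.mpr hqn)

end Rmk241


section Rmk241Closed

open PadicInt in
/-- **The PRINTED Rmk. 2.4.1 dichotomy holds at the model `ℤ_p`** (p. 71: "every closed subgroup of such a
maximal pro-`l'` subgroup [≅ `ℤ_{l'}`] is either open or trivial"): a CLOSED additive subgroup of `ℤ_p` is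
`⊥` or of finite index (hence open). Proof: by density of `ℤ` in `ℤ_p` and closedness, the subgroup is an
ideal; a nonzero ideal of `ℤ_p` is `(p^n)`, whose quotient is `ℤ/p^nℤ`. This is the statement the repair
`Rmk241_openOrTrivial'` (with the closure hypothesis) asserts abstractly. [cite: Mochizuki2012, Rmk 2.4.1 p.71] -/
theorem closed_addSubgroup_padicInt_bot_or_finiteIndex (p : ℕ) [hp : Fact p.Prime]
    (A : AddSubgroup ℤ_[p]) (hA : IsClosed (A : Set ℤ_[p])) : A = ⊥ ∨ A.FiniteIndex := by
  classical
  -- `A` is stable under multiplication by `ℤ_p` (density of `ℤ`, closedness of `A`)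
  have hmul : ∀ c x : ℤ_[p], x ∈ A → c * x ∈ A := by
    intro c x hx
    refine (denseRange_intCast (p := p)).induction_on (p := fun c : ℤ_[p] => c * x ∈ A) c ?_ ?_
    · exact hA.preimage (continuous_id.mul continuous_const)
    · intro n
      rw [← zsmul_eq_mul]
      exact A.zsmul_mem hx n
  -- hence an ideal of `ℤ_p`
  let I : Ideal ℤ_[p] :=
    { carrier := A
      add_mem' := fun ha hb => A.add_mem ha hb
      zero_mem' := A.zero_mem
      smul_mem' := fun c x hx => by simpa [smul_eq_mul] using hmul c x hx }
  have hIA : I.toAddSubgroup = A := AddSubgroup.ext fun _ => Iff.rfl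
  by_cases hbot : A = ⊥
  · exact Or.inl hbot
  right
  have hI : I ≠ ⊥ := by
    intro h
    apply hbot
    rw [← hIA, h]
    rfl
  -- a nonzero ideal is `(p^n)`, with quotient `ℤ/p^nℤ`
  obtain ⟨n, hn⟩ := ideal_eq_span_pow_p hI
  have hker : RingHom.ker (toZModPow n : ℤ_[p] →+* ZMod (p ^ n)) = I := by rw [ker_toZModPow, hn]
  have hsurj : Function.Surjective (toZModPow n : ℤ_[p] →+* ZMod (p ^ n)) := ZMod.ringHom_surjective _
  haveI : NeZero (p ^ n) := ⟨pow_ne_zero _ hp.out.ne_zero⟩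
  let e : ℤ_[p] ⧸ I ≃+* ZMod (p ^ n) :=
    (Ideal.quotEquivOfEq hker.symm).trans (RingHom.quotientKerEquivOfSurjective hsurj)
  haveI hfin : Finite (ℤ_[p] ⧸ I) := Finite.of_equiv _ e.toEquiv.symm
  have hfin' : Finite (ℤ_[p] ⧸ A) := by
    rw [← hIA]
    exact hfin
  exact AddSubgroup.finiteIndex_of_finite_quotient

end Rmk241Closed

end Literature.IUT.HodgeArakelov
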